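import Summits.BirchSwinnertonDyer.Rank1Residual.X2.IntSeriesFirstUnitCoeff
import Summits.BirchSwinnertonDyer.Rank1Residual.X11b.IntSeriesComposition
import Summits.BirchSwinnertonDyer.Rank1Residual.Additive.PowerMapSubstitution
import HarnessLib

/-!
# Zeros of `𝓞_{ℂ_p}⟦T⟧`-series in the open disc FACTOR OFF with a bounded cofactor, and the
# factorisation respects the first-unit index and the `p`-power-map functional equation
# (helper file for crux `GoodLatticeBDPValue`, stmt-BirchSwinnertonDyer-19032, line `halves`, piece AN-F₂)

Seat `bsd-line-x1-p1-w4` (D-0154 width seat on crux 2 of route `EisensteinPrimes`, line `halves` v17;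
ideator card `Cruxes/GoodLatticeBDPValue/Lines/halves_anDS_split_idea11g4` rev 2, piece AN-F₂
`KatzLineDescentAt`, route (RIG)). THEOREMS ONLY (elementary `p`-adic analysis on the wide receptacle
`𝓞_{ℂ_p}⟦T⟧ = PowerSeries 𝓞_ℂ_[p]`; no definition, no named fact, no `sorry`; imports no `Theses` module).
`--supports stmt-BirchSwinnertonDyer-19032`.

WHY. Route (RIG) of AN-F₂ transports the first-unit index («`μ = 0` and `λ = m`») from ONE
`𝓞_{ℂ_p}`-valued CGLS-type frame `Q` of `θ_K` to EVERY `R₀`-valued frame `L` with other periods. The two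
frames satisfy the `p`-POWER-MAP functional equation `L(Φ)·Q^p = L^p·Q(Φ)`, `Φ = (1+T)^p − 1` (cell
bsd-cn100's device, `UniversalToricDescentBDPFlatMuTransfer.flat_powerMap_identity_of_values`), and the
`λ`-rigidity of that equation (sequel file `…KatzLineLambdaRigidity`) is proved by induction on the
first-unit index: a COMMON ZERO `z` (‖z‖ < 1) of `Q` and `L` is divided out. This file supplies the
division step, which over the non-noetherian, non-discretely-valued `𝓞_{ℂ_p}` is NOT Weierstrass
preparation but the elementary tail-sum factorisation (Cassels, *Local Fields*, Ch. 4 Lemma 2.1 /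
Gouvêa §5.6): if `Q(z) = 0` then `Q = (T − z)·Q₁` with `[T^k]Q₁ = Σ_{i} [T^{i+k+1}]Q · z^i`, and these
tail sums have norm `≤ 1`.

* §1 values: `norm_value_le_one`; tails `hasValueAt_tail`, the recursion `tail_eq` /
  `value_eq_constantCoeff_add`.
* §2 **`exists_eq_X_sub_C_mul_of_hasValueAt_zero`** — `‖z‖ < 1`, `Q(z) = 0` ⟹ `∃ Q₁, Q = (X − C z)·Q₁`.
* §3 bookkeeping for the factor `X − C z`: its first-unit index is `1` (`firstUnitCoeffAt_X_sub_C`), so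
  `Q₁` has first-unit index `m − 1` when `Q` has `m` (`exists_firstUnitCoeffAt_of_X_sub_C_mul`, via
  `X2.CpIntSeries.exists_firstUnitCoeffAt_right`); the NEAR REGIME `‖Q(y)‖ = ‖Q(0)‖` for
  `‖y‖ < ‖Q(0)‖` (`norm_value_eq_norm_constantCoeff`; so a series with first-unit index `0` has no zero in
  the open disc) and `hasValueAt_zero`; and the power-map functional equation
  DESCENDS to the cofactors (`powMap_identity_of_X_sub_C_mul`: cancel `(Φ − z)·(X − z)^p` in the domain
  `𝓞_{ℂ_p}⟦T⟧`).

References: [Cassels1986] J. W. S. Cassels, *Local Fields*, LMS Student Texts 3 (1986), Ch. 4 Lemma 2.1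
and Thm. 4.1 (Strassmann); [Gouvea1993PadicNumbers] §5.6; [Washington1997] §7.1 Prop. 7.2, §7.2 (the
`p`-power map).
-/

set_option linter.dupNamespace false
set_option autoImplicit false

noncomputable section

open scoped Classical Topology
open Filter PowerSeries Literature.NumberTheory.EllipticCurves
  Summit.BirchSwinnertonDyer.Rank1Residual Summit.BirchSwinnertonDyer.Rank1Residual.X11b

namespace Summit.BirchSwinnertonDyer.BirchSwinnertonDyer.Theorems.KatzLineRigidity

variable {p : ℕ} [hp : Fact p.Prime]

/-! ### §1 Values and tail sums -/

/-- A value of `Q ∈ 𝓞_{ℂ_p}⟦T⟧` at a point of the closed unit disc has norm `≤ 1` (every term does;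
ultrametric). [cite: Gouvea1993PadicNumbers, §5.6] -/
theorem norm_value_le_one {Q : PowerSeries 𝓞_ℂ_[p]} {x v : ℂ_[p]} (hx : ‖x‖ ≤ 1)
    (hv : IntSeries.HasValueAt Q x v) : ‖v‖ ≤ 1 := by
  rw [← hv.tsum_eq]
  refine IsUltrametricDist.norm_tsum_le_of_forall_le_of_nonneg zero_le_one fun k ↦ ?_
  rw [norm_mul, norm_pow]
  exact mul_le_one₀ (R1.norm_coe_padicComplexInt_le_one p _) (pow_nonneg (norm_nonneg _) _)
    (pow_le_one₀ (norm_nonneg _) hx)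

/-- The `k`-th TAIL of `Q` at `z`, `Σ_i [T^{i+k}]Q · z^i`, is the value at `z` of the shifted series
`Σ_i [T^{i+k}]Q · T^i`; on the open disc it exists. [cite: Cassels1986, Ch. 4 Lemma 2.1] -/
theorem hasValueAt_tail (Q : PowerSeries 𝓞_ℂ_[p]) {z : ℂ_[p]} (hz : ‖z‖ < 1) (k : ℕ) :
    IntSeries.HasValueAt (PowerSeries.mk fun i ↦ coeff (i + k) Q) z
      (∑' i : ℕ, ((coeff (i + k) Q : 𝓞_ℂ_[p]) : ℂ_[p]) * z ^ i) := by
  have h := intSeries_hasValueAt_tsum (PowerSeries.mk fun i ↦ coeff (i + k) Q) hz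
  simpa only [coeff_mk] using h

/-- **Tail recursion**: `t_k = [T^k]Q + z·t_{k+1}` for the tails `t_k = Σ_i [T^{i+k}]Q · z^i`.
[cite: Cassels1986, Ch. 4 Lemma 2.1] -/
theorem tail_eq {Q : PowerSeries 𝓞_ℂ_[p]} {z : ℂ_[p]} (k : ℕ) {t t' : ℂ_[p]}
    (ht : IntSeries.HasValueAt (PowerSeries.mk fun i ↦ coeff (i + k) Q) z t)
    (ht' : IntSeries.HasValueAt (PowerSeries.mk fun i ↦ coeff (i + (k + 1)) Q) z t') :
    t = ((coeff k Q : 𝓞_ℂ_[p]) : ℂ_[p]) + z * t' := by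
  unfold IntSeries.HasValueAt at ht ht'
  simp only [coeff_mk] at ht ht'
  have h2 : HasSum (fun i : ℕ ↦ ((coeff (i + 1 + k) Q : 𝓞_ℂ_[p]) : ℂ_[p]) * z ^ (i + 1))
      (z * t') := by
    refine (ht'.mul_left z).congr_fun fun i ↦ ?_
    rw [show i + 1 + k = i + (k + 1) by ring, pow_succ]
    ring
  have h3 := HasSum.zero_add (f := fun i : ℕ ↦ ((coeff (i + k) Q : 𝓞_ℂ_[p]) : ℂ_[p]) * z ^ i) h2
  have h4 := ht.unique h3
  simpa using h4

/-- The value of `Q` at `z` is `[T^0]Q + z·t_1` (`t_1` the first tail). [cite: Cassels1986, Ch. 4 Lemma 2.1] -/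
theorem value_eq_constantCoeff_add {Q : PowerSeries 𝓞_ℂ_[p]} {z v t' : ℂ_[p]}
    (hv : IntSeries.HasValueAt Q z v)
    (ht' : IntSeries.HasValueAt (PowerSeries.mk fun i ↦ coeff (i + 1) Q) z t') :
    v = ((constantCoeff Q : 𝓞_ℂ_[p]) : ℂ_[p]) + z * t' := by
  have hv' : IntSeries.HasValueAt (PowerSeries.mk fun i ↦ coeff (i + 0) Q) z v := by
    unfold IntSeries.HasValueAt at hv ⊢
    simpa only [coeff_mk, add_zero] using hv
  have h := tail_eq (Q := Q) 0 hv' (by simpa using ht')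
  rwa [coeff_zero_eq_constantCoeff] at h

/-! ### §2 A zero in the open disc factors off with a bounded cofactor -/

/-- **Factor lemma.** If `Q ∈ 𝓞_{ℂ_p}⟦T⟧` vanishes at a point `z` of the open unit disc of `ℂ_p`
(so `z ∈ 𝓞_{ℂ_p}`), then `Q = (T − z)·Q₁` for some `Q₁ ∈ 𝓞_{ℂ_p}⟦T⟧`: take `[T^k]Q₁ := t_{k+1}`, the
`(k+1)`-st tail sum of `Q` at `z` (norm `≤ 1`); the tail recursion `t_k = [T^k]Q + z·t_{k+1}` gives the
coefficients of `(T − z)·Q₁` in degrees `≥ 1`, and `Q(z) = 0`, i.e. `[T^0]Q = −z·t_1`, the constant one.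
[cite: Cassels1986, Ch. 4 Lemma 2.1] [cite: Gouvea1993PadicNumbers, §5.6] -/
theorem exists_eq_X_sub_C_mul_of_hasValueAt_zero {Q : PowerSeries 𝓞_ℂ_[p]} {z : 𝓞_ℂ_[p]}
    (hz : ‖(z : ℂ_[p])‖ < 1) (hQz : IntSeries.HasValueAt Q (z : ℂ_[p]) 0) :
    ∃ Q₁ : PowerSeries 𝓞_ℂ_[p], Q = (X - C z) * Q₁ := by
  -- the tails `t k := Σ_i [T^{i+k}]Q z^i`
  set t : ℕ → ℂ_[p] := fun k ↦ ∑' i : ℕ, ((coeff (i + k) Q : 𝓞_ℂ_[p]) : ℂ_[p]) * (z : ℂ_[p]) ^ i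
    with ht_def
  have ht : ∀ k, IntSeries.HasValueAt (PowerSeries.mk fun i ↦ coeff (i + k) Q) (z : ℂ_[p]) (t k) :=
    fun k ↦ hasValueAt_tail Q hz k
  have ht_le : ∀ k, ‖t k‖ ≤ 1 := fun k ↦ norm_value_le_one hz.le (ht k)
  have ht_mem : ∀ k, t k ∈ 𝓞_ℂ_[p] := fun k ↦
    Literature.NumberTheory.LFunctions.Dwork.mem_unitBall.mpr (ht_le k)
  -- the recursion and the vanishing at `z`
  have hrec : ∀ k, t k = ((coeff k Q : 𝓞_ℂ_[p]) : ℂ_[p]) + (z : ℂ_[p]) * t (k + 1) :=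
    fun k ↦ tail_eq k (ht k) (ht (k + 1))
  have h0 : ((constantCoeff Q : 𝓞_ℂ_[p]) : ℂ_[p]) + (z : ℂ_[p]) * t 1 = 0 := by
    have h := hrec 0
    rw [coeff_zero_eq_constantCoeff] at h
    have hv : IntSeries.HasValueAt Q (z : ℂ_[p]) (t 0) := by
      have := ht 0
      unfold IntSeries.HasValueAt at this ⊢
      simpa only [coeff_mk, add_zero] using this
    rw [← h]
    exact hv.unique hQz
  refine ⟨PowerSeries.mk fun k ↦ (⟨t (k + 1), ht_mem (k + 1)⟩ : 𝓞_ℂ_[p]), ?_⟩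
  ext n
  rcases n with _ | k
  · -- constant coefficient: `[T^0]Q = −z·t_1`
    rw [sub_mul, map_sub, coeff_zero_X_mul, coeff_C_mul, coeff_mk, zero_sub]
    have e1 : (((⟨t (0 + 1), ht_mem (0 + 1)⟩ : 𝓞_ℂ_[p]) : ℂ_[p])) = t 1 := rfl
    rw [NegMemClass.coe_neg, MulMemClass.coe_mul, e1, coeff_zero_eq_constantCoeff]
    linear_combination h0
  · -- degree `k+1`: `[T^{k+1}]Q = t_{k+1} − z·t_{k+2}`
    rw [sub_mul, map_sub, coeff_succ_X_mul, coeff_C_mul, coeff_mk, coeff_mk]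
    have e1 : (((⟨t (k + 1), ht_mem (k + 1)⟩ : 𝓞_ℂ_[p]) : ℂ_[p])) = t (k + 1) := rfl
    have e2 : (((⟨t (k + 1 + 1), ht_mem (k + 1 + 1)⟩ : 𝓞_ℂ_[p]) : ℂ_[p])) = t (k + 1 + 1) := rfl
    rw [AddSubgroupClass.coe_sub, MulMemClass.coe_mul, e1, e2]
    linear_combination (-1 : ℂ_[p]) * hrec (k + 1)

/-! ### §3 The factor `X − C z`: first-unit index, no-zero criterion, descent of the functional equation -/

/-- `X − C z` (`‖z‖ < 1`) has its first unit coefficient at index `1`. [cite: Washington1997, §7.1 Prop. 7.2] -/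
theorem firstUnitCoeffAt_X_sub_C {z : 𝓞_ℂ_[p]} (hz : ‖(z : ℂ_[p])‖ < 1) :
    ‖((coeff 1 (X - C z : PowerSeries 𝓞_ℂ_[p]) : 𝓞_ℂ_[p]) : ℂ_[p])‖ = 1 ∧
      ∀ i < 1, ‖((coeff i (X - C z : PowerSeries 𝓞_ℂ_[p]) : 𝓞_ℂ_[p]) : ℂ_[p])‖ < 1 := by
  refine ⟨?_, fun i hi ↦ ?_⟩
  · rw [map_sub, coeff_one_X, coeff_C, if_neg one_ne_zero, sub_zero, OneMemClass.coe_one, norm_one]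
  · obtain rfl : i = 0 := by omega
    rw [map_sub, coeff_zero_X, coeff_zero_C, zero_sub, NegMemClass.coe_neg, norm_neg]
    exact hz

/-- **Index bookkeeping**: if `Q = (X − C z)·Q₁` (`‖z‖ < 1`) has its first unit coefficient at `m`, then
`1 ≤ m` and `Q₁` has its first unit coefficient at `m − 1` (indices add: the tree's
`X2.CpIntSeries.exists_firstUnitCoeffAt_right`). [cite: Washington1997, §7.1 Prop. 7.2] -/
theorem exists_firstUnitCoeffAt_of_X_sub_C_mul {Q Q₁ : PowerSeries 𝓞_ℂ_[p]} {z : 𝓞_ℂ_[p]} {m : ℕ}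
    (hz : ‖(z : ℂ_[p])‖ < 1) (hQ : Q = (X - C z) * Q₁)
    (hm : ‖((coeff m Q : 𝓞_ℂ_[p]) : ℂ_[p])‖ = 1 ∧ ∀ i < m, ‖((coeff i Q : 𝓞_ℂ_[p]) : ℂ_[p])‖ < 1) :
    1 ≤ m ∧ (‖((coeff (m - 1) Q₁ : 𝓞_ℂ_[p]) : ℂ_[p])‖ = 1 ∧
      ∀ i < m - 1, ‖((coeff i Q₁ : 𝓞_ℂ_[p]) : ℂ_[p])‖ < 1) := by
  rw [hQ] at hm
  obtain ⟨b, hb, hab⟩ := X2.CpIntSeries.exists_firstUnitCoeffAt_right (firstUnitCoeffAt_X_sub_C hz) hm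
  refine ⟨by omega, ?_⟩
  obtain rfl : b = m - 1 := by omega
  exact hb

/-- The value at `0` is the constant term. [folklore] -/
theorem hasValueAt_zero (Q : PowerSeries 𝓞_ℂ_[p]) :
    IntSeries.HasValueAt Q 0 ((constantCoeff Q : 𝓞_ℂ_[p]) : ℂ_[p]) := by
  unfold IntSeries.HasValueAt
  have h := hasSum_single (f := fun k : ℕ ↦ ((coeff k Q : 𝓞_ℂ_[p]) : ℂ_[p]) * (0 : ℂ_[p]) ^ k) 0
    (fun k hk ↦ by rw [zero_pow hk, mul_zero])
  simpa using h

/-- **Near regime**: if `‖y‖ < ‖[T^0]Q‖` (and `‖y‖ ≤ 1`) then `‖Q(y)‖ = ‖[T^0]Q‖`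
(`‖Q(y) − Q(0)‖ ≤ ‖y‖`). In particular a series with a UNIT constant term has no zero in the open disc.
[cite: Cassels1986, Ch. 4 Lemma 2.1] -/
theorem norm_value_eq_norm_constantCoeff {Q : PowerSeries 𝓞_ℂ_[p]} {y v : ℂ_[p]} (hy : ‖y‖ ≤ 1)
    (hlt : ‖y‖ < ‖((constantCoeff Q : 𝓞_ℂ_[p]) : ℂ_[p])‖) (hv : IntSeries.HasValueAt Q y v) :
    ‖v‖ = ‖((constantCoeff Q : 𝓞_ℂ_[p]) : ℂ_[p])‖ := by
  have hle := intSeries_norm_value_sub_constantCoeff_le hy hv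
  have hlt' : ‖v - ((constantCoeff Q : 𝓞_ℂ_[p]) : ℂ_[p])‖ < ‖((constantCoeff Q : 𝓞_ℂ_[p]) : ℂ_[p])‖ :=
    hle.trans_lt hlt
  calc ‖v‖ = ‖(v - ((constantCoeff Q : 𝓞_ℂ_[p]) : ℂ_[p])) + ((constantCoeff Q : 𝓞_ℂ_[p]) : ℂ_[p])‖ := by
        rw [sub_add_cancel]
    _ = max ‖v - ((constantCoeff Q : 𝓞_ℂ_[p]) : ℂ_[p])‖ ‖((constantCoeff Q : 𝓞_ℂ_[p]) : ℂ_[p])‖ :=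
        IsUltrametricDist.norm_add_eq_max_of_norm_ne_norm (ne_of_lt hlt')
    _ = ‖((constantCoeff Q : 𝓞_ℂ_[p]) : ℂ_[p])‖ := max_eq_right hlt'.le

/-- The `p`-power map `Φ = (1+X)^p − 1` substituted into `X − C z` gives `Φ − C z`. [folklore] -/
theorem subst_powMap_X_sub_C (z : 𝓞_ℂ_[p]) :
    (X - C z : PowerSeries 𝓞_ℂ_[p]).subst (((1 + X : PowerSeries 𝓞_ℂ_[p]) ^ p) - 1) =
      ((((1 + X : PowerSeries 𝓞_ℂ_[p]) ^ p) - 1) - C z) := by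
  rw [subst_sub (hasSubst_powMap p), subst_X (hasSubst_powMap p), subst_C]
  rfl

/-- `X − C z ≠ 0` in `𝓞_{ℂ_p}⟦T⟧` (its coefficient of `X` is `1`). [folklore] -/
theorem X_sub_C_ne_zero (z : 𝓞_ℂ_[p]) : (X - C z : PowerSeries 𝓞_ℂ_[p]) ≠ 0 := by
  intro h
  have h1 := congrArg (coeff 1) h
  rw [map_sub, coeff_one_X, coeff_C, if_neg one_ne_zero, sub_zero, map_zero] at h1
  exact one_ne_zero h1

/-- The `p`-power map is injective on `𝓞_{ℂ_p}⟦T⟧`: `F ≠ 0 ⟹ F(Φ) ≠ 0` (b2b-bsdres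
`Additive.eq_zero_of_subst_one_add_X_pow_sub_one_eq_zero`; `𝓞_{ℂ_p}` is a domain of characteristic `0`).
[cite: Washington1997, §7.2 (the p-power map)] -/
theorem subst_powMap_ne_zero {F : PowerSeries 𝓞_ℂ_[p]} (hF : F ≠ 0) :
    F.subst (((1 + X : PowerSeries 𝓞_ℂ_[p]) ^ p) - 1) ≠ 0 := fun h ↦
  hF (Additive.eq_zero_of_subst_one_add_X_pow_sub_one_eq_zero p hp.out.ne_zero h)

/-- **The functional equation descends to the cofactors.** If `Q = (X − C z)·Q₁`, `L = (X − C z)·L₁` and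
`L(Φ)·Q^p = L^p·Q(Φ)` (`Φ = (1+X)^p − 1`), then `L₁(Φ)·Q₁^p = L₁^p·Q₁(Φ)`: substitution is a ring map,
and the common factor `(Φ − z)·(X − z)^p ≠ 0` cancels in the domain `𝓞_{ℂ_p}⟦T⟧`.
[cite: Washington1997, §7.2 (the p-power map)] -/
theorem powMap_identity_of_X_sub_C_mul {Q L Q₁ L₁ : PowerSeries 𝓞_ℂ_[p]} {z : 𝓞_ℂ_[p]}
    (hQ : Q = (X - C z) * Q₁) (hL : L = (X - C z) * L₁)
    (h : L.subst (((1 + X : PowerSeries 𝓞_ℂ_[p]) ^ p) - 1) * Q ^ p =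
      L ^ p * Q.subst (((1 + X : PowerSeries 𝓞_ℂ_[p]) ^ p) - 1)) :
    L₁.subst (((1 + X : PowerSeries 𝓞_ℂ_[p]) ^ p) - 1) * Q₁ ^ p =
      L₁ ^ p * Q₁.subst (((1 + X : PowerSeries 𝓞_ℂ_[p]) ^ p) - 1) := by
  set Φ : PowerSeries 𝓞_ℂ_[p] := ((1 + X : PowerSeries 𝓞_ℂ_[p]) ^ p) - 1 with hΦdef
  set lam : PowerSeries 𝓞_ℂ_[p] := X - C z with hlam
  have hΦ : HasSubst Φ := hasSubst_powMap (p := p) p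
  rw [hQ, hL, subst_mul hΦ, subst_mul hΦ, mul_pow, mul_pow] at h
  have hne : lam.subst Φ * lam ^ p ≠ 0 :=
    mul_ne_zero (subst_powMap_ne_zero (X_sub_C_ne_zero z)) (pow_ne_zero _ (X_sub_C_ne_zero z))
  have key : lam.subst Φ * lam ^ p * (L₁.subst Φ * Q₁ ^ p) =
      lam.subst Φ * lam ^ p * (L₁ ^ p * Q₁.subst Φ) := by
    calc lam.subst Φ * lam ^ p * (L₁.subst Φ * Q₁ ^ p)
        = lam.subst Φ * L₁.subst Φ * (lam ^ p * Q₁ ^ p) := by ring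
      _ = lam ^ p * L₁ ^ p * (lam.subst Φ * Q₁.subst Φ) := h
      _ = lam.subst Φ * lam ^ p * (L₁ ^ p * Q₁.subst Φ) := by ring
  exact mul_left_cancel₀ hne key

end Summit.BirchSwinnertonDyer.BirchSwinnertonDyer.Theorems.KatzLineRigidity

end
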